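import Mathlib.RepresentationTheory.Character
import Mathlib.RepresentationTheory.Maschke
import Mathlib.RepresentationTheory.Semisimple
import Summits.BirchSwinnertonDyer.BirchSwinnertonDyer.Theorems.ClassRecordThreeEulerHalvesAtThreeCartanSupplyTraceTools
import HarnessLib

/-!
# Crux 23422 line `cartan` v11, stub SUPPLY (`CartanTorusLatticeSupply`), road C1 — the GENERIC ENGINE, part 1:
# «a virtual character of norm one and positive degree is an irreducible character» WITHOUT decomposition into simples

Seat `bsd-idea-10` (g13), `--supports stmt-BirchSwinnertonDyer-19109 --as helper`. This is the generic character theory that tam3-p1 g23's memo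
`SUPPLY-ROAD-GG1.md` §3 road C1 asks of bsd-idea-10 («χ_W = χ_A − χ_B virtual of norm 1 ⇒ irreducible ⇒ the isotypic kernel has `trace_eq`»),
over an arbitrary field `k` of characteristic zero (no algebraic closure, no Wedderburn, no decomposition into simples):

* §1 characters of subquotients along an intertwiner (from tam3-p1's `TraceTools` p697419): `χ_B = χ_{ker φ} + χ_{range φ}`,
  `χ_{A ∕ W} = χ_A − χ_W`, with the rank bookkeeping;
* §2 `finrank End_G(V) = 1 ⇒ V irreducible` (Maschke: a proper non-zero subrepresentation has a stable complement, whose projection is a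
  second, linearly independent, endomorphism);
* §3 the HOM-STRIPPING INDUCTION: if `f = χ_A − χ_B` with `Σ_g f(g)f(g⁻¹) = |G|` and `dim B < dim A`, then `f` is the character of an
  irreducible subquotient `U` of `A` with one-dimensional commutant. Step: a non-zero intertwiner `B → A` (or `A → B`)
  replaces `(A, B)` by `(A ∕ range, ker)` (resp. `(ker, B ∕ range)`), lowering `dim B`; when both Hom spaces vanish, expanding the norm gives
  `dim End_G A + dim End_G B = 1`, so `B = 0` and `End_G A = k`.

Part 2 (`…CartanSupplyVirtualCharacterSums`) derives the two sums (α) `f(1)·Σ_h f(h⁻¹)f(hk) = |G|·f(k)` and (β) `f(1)·Σ_h f(h⁻¹)χ_V(gh) = |G|·f(g)`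
(multiplicity one) for such an irreducible `U`; part 3 packages them for `GL₂(𝔽_q)` into `CartanConvolutionSupply`.
HONEST FRAMING: generic finite-group representation theory only; no statement about `cubicNewvectorChar`, no route item, no summit statement is
proved here. References: [cite: SerreLinearRepresentations1977, §2.3 Thm. 5 & §2.6 Thm. 8] (the classical statements; our proofs avoid §2.4's decomposition)
[folklore].
-/

set_option linter.dupNamespace false
set_option autoImplicit false

noncomputable section

namespace Summit.BirchSwinnertonDyer.BirchSwinnertonDyer.Theorems.CartanSupply.VirtualCharacter

open Module Representation
open Summit.BirchSwinnertonDyer.BirchSwinnertonDyer.Theorems.CartanSupply.TraceTools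

universe u v

/-! ## §1 Characters of subquotients along an intertwining map -/

section subquotient

variable {k : Type*} [Field k] {G : Type*} [Group G]
  {VA : Type u} {VB : Type v} [AddCommGroup VA] [Module k VA] [FiniteDimensional k VA]
  [AddCommGroup VB] [Module k VB] [FiniteDimensional k VB]
  (ρA : Representation k G VA) (ρB : Representation k G VB)

omit [FiniteDimensional k VA] in
/-- PROVED: a subrepresentation is stable, in the `comap` form `Representation.quotient` wants. [folklore] -/
theorem le_comap_of_subrepresentation (W : Subrepresentation ρA) (g : G) :
    W.toSubmodule ≤ W.toSubmodule.comap (ρA g) := fun _ hv => W.apply_mem_toSubmodule g hv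

/-- The quotient of a representation by a subrepresentation. -/
def quot (W : Subrepresentation ρA) : Representation k G (VA ⧸ W.toSubmodule) :=
  ρA.quotient W.toSubmodule (le_comap_of_subrepresentation ρA W)

omit [FiniteDimensional k VA] in
/-- PROVED: the trace of a restriction depends only on the submodule. [folklore] -/
theorem trace_restrict_congr {p p' : Submodule k VA} (e : p = p') (f : Module.End k VA)
    (hp : ∀ x ∈ p, f x ∈ p) (hp' : ∀ x ∈ p', f x ∈ p') :
    LinearMap.trace k p (f.restrict hp) = LinearMap.trace k p' (f.restrict hp') := by
  subst e
  rfl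

omit [FiniteDimensional k VA] in
/-- PROVED — `χ_B = χ_{ker φ} + χ_{range φ}` for an intertwiner `φ : B → A` (tam3-p1's trace additivity). [folklore] -/
theorem char_eq_char_ker_add_char_range (φ : IntertwiningMap ρB ρA) (g : G) :
    ρB.character g = φ.ker.toRepresentation.character g + φ.range.toRepresentation.character g :=
  trace_eq_trace_restrict_ker_add_trace_restrict_range φ.toLinearMap (ρB g) (ρA g) (φ.isIntertwining' g)

/-- PROVED — `χ_{A ∕ W} = χ_A − χ_W` for a subrepresentation `W ≤ A`. [folklore] -/
theorem char_quot (W : Subrepresentation ρA) (g : G) :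
    (quot ρA W).character g = ρA.character g - W.toRepresentation.character g := by
  have hc : W.toSubmodule.mkQ ∘ₗ ρA g = (quot ρA W g) ∘ₗ W.toSubmodule.mkQ := by
    apply LinearMap.ext
    intro v
    rfl
  have h := trace_eq_trace_sub_trace_restrict_ker_of_surjective W.toSubmodule.mkQ (ρA g) (quot ρA W g) hc
    (Submodule.mkQ_surjective _)
  unfold Representation.character
  rw [h]
  congr 1
  exact trace_restrict_congr (Submodule.ker_mkQ _) _ _ (fun x hx => W.apply_mem_toSubmodule g hx)

omit [FiniteDimensional k VA] in
/-- PROVED: rank–nullity for an intertwiner. [folklore] -/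
theorem finrank_ker_add_finrank_range (φ : IntertwiningMap ρB ρA) :
    finrank k φ.ker.toSubmodule + finrank k φ.range.toSubmodule = finrank k VB := by
  rw [add_comm]
  exact LinearMap.finrank_range_add_finrank_ker φ.toLinearMap

/-- PROVED: rank of a quotient. [folklore] -/
theorem finrank_quot_add_finrank (W : Subrepresentation ρA) :
    finrank k (VA ⧸ W.toSubmodule) + finrank k W.toSubmodule = finrank k VA :=
  Submodule.finrank_quotient_add_finrank W.toSubmodule

omit [FiniteDimensional k VA] in
/-- PROVED: a non-zero intertwiner has a range of positive rank. [folklore] -/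
theorem finrank_range_pos (φ : IntertwiningMap ρB ρA) (hφ : φ ≠ 0) : 0 < finrank k φ.range.toSubmodule := by
  rw [Nat.pos_iff_ne_zero]
  intro h0
  apply hφ
  have hbot : LinearMap.range φ.toLinearMap = ⊥ := (Submodule.finrank_eq_zero.mp h0)
  exact IntertwiningMap.ext (LinearMap.range_eq_bot.mp hbot)

end subquotient

/-! ## §2 One-dimensional commutant ⇒ irreducible (Maschke) -/

section irreducible

variable {k : Type*} [Field k] {G : Type*} [Group G]
  {V : Type u} [AddCommGroup V] [Module k V] (ρ : Representation k G V)

/-- The projection onto a subrepresentation along a `G`-stable complement is an intertwining map. -/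
def projG {W W' : Subrepresentation ρ} (hc : IsCompl W.toSubmodule W'.toSubmodule) : IntertwiningMap ρ ρ where
  toLinearMap := W.toSubmodule.projection W'.toSubmodule hc
  isIntertwining' g := by
    apply LinearMap.ext
    intro v
    simp only [LinearMap.coe_comp, Function.comp_apply]
    have hv := Submodule.projection_add_projection_eq_self hc v
    have h1 : ρ g (W.toSubmodule.projection W'.toSubmodule hc v) ∈ W.toSubmodule :=
      W.apply_mem_toSubmodule g (Submodule.projection_apply_mem hc v)
    have h2 : ρ g (W'.toSubmodule.projection W.toSubmodule hc.symm v) ∈ W'.toSubmodule :=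
      W'.apply_mem_toSubmodule g (Submodule.projection_apply_mem hc.symm v)
    calc W.toSubmodule.projection W'.toSubmodule hc (ρ g v)
        = W.toSubmodule.projection W'.toSubmodule hc
            (ρ g (W.toSubmodule.projection W'.toSubmodule hc v) + ρ g (W'.toSubmodule.projection W.toSubmodule hc.symm v)) := by
          rw [← map_add, hv]
      _ = ρ g (W.toSubmodule.projection W'.toSubmodule hc v) := by
          rw [map_add, Submodule.projection_apply_of_mem_left hc h1, Submodule.projection_apply_of_mem_right hc h2, add_zero]

/-- PROVED: the underlying map of `projG`. [folklore] -/
theorem projG_apply {W W' : Subrepresentation ρ} (hc : IsCompl W.toSubmodule W'.toSubmodule) (v : V) :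
    projG ρ hc v = W.toSubmodule.projection W'.toSubmodule hc v := rfl

/-- PROVED: a representation with one-dimensional commutant lives on a non-trivial space. [folklore] -/
theorem nontrivial_of_finrank_intertwiningMap_eq_one (h : finrank k (IntertwiningMap ρ ρ) = 1) : Nontrivial V := by
  by_contra hV'
  haveI : Subsingleton V := not_nontrivial_iff_subsingleton.mp hV'
  haveI : Subsingleton (IntertwiningMap ρ ρ) :=
    ⟨fun f g => IntertwiningMap.ext (LinearMap.ext fun v => Subsingleton.elim _ _)⟩
  have h0 : finrank k (IntertwiningMap ρ ρ) = 0 := Module.finrank_zero_of_subsingleton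
  omega

/-- PROVED: on a non-trivial space the identity intertwiner is non-zero. [folklore] -/
theorem id_ne_zero [Nontrivial V] : IntertwiningMap.id ρ ≠ 0 := by
  obtain ⟨v, hv⟩ := exists_ne (0 : V)
  intro h0
  apply hv
  have := congrArg (fun f : IntertwiningMap ρ ρ => f v) h0
  simpa using this

variable [Fintype G]

/-- PROVED — **ONE-DIMENSIONAL COMMUTANT ⇒ IRREDUCIBLE** (finite group, `|G|` invertible in `k`): a proper non-zero subrepresentation
`W` has a `G`-stable complement (Maschke), and the projection onto `W` along it is an intertwiner which is not a multiple of the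
identity. [folklore] -/
theorem isIrreducible_of_finrank_intertwiningMap_eq_one [NeZero (Nat.card G : k)]
    (h : finrank k (IntertwiningMap ρ ρ) = 1) : IsIrreducible ρ := by
  haveI hV : Nontrivial V := nontrivial_of_finrank_intertwiningMap_eq_one ρ h
  have hid : IntertwiningMap.id ρ ≠ 0 := id_ne_zero ρ
  haveI : IsSemisimpleRepresentation ρ :=
    (isSemisimpleRepresentation_iff_isSemisimpleModule_asModule ρ).2 inferInstance
  haveI : Nontrivial (Subrepresentation ρ) := ⟨⟨⊥, ⊤, fun e => by
    have := congrArg Subrepresentation.toSubmodule e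
    exact bot_ne_top (α := Submodule k V) this⟩⟩
  refine ⟨fun W => ?_⟩
  obtain ⟨W', hWW'⟩ := exists_isCompl W
  have hc : IsCompl W.toSubmodule W'.toSubmodule := by
    constructor
    · rw [disjoint_iff]
      exact congrArg Subrepresentation.toSubmodule hWW'.inf_eq_bot
    · rw [codisjoint_iff]
      exact congrArg Subrepresentation.toSubmodule hWW'.sup_eq_top
  obtain ⟨c, hcπ⟩ := (finrank_eq_one_iff_of_nonzero' (IntertwiningMap.id ρ) hid).mp h (projG ρ hc)
  have hπ : ∀ v, W.toSubmodule.projection W'.toSubmodule hc v = c • v := fun v => by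
    have := congrArg (fun f : IntertwiningMap ρ ρ => f v) hcπ
    rw [IntertwiningMap.smul_apply, IntertwiningMap.id_apply, projG_apply] at this
    exact this.symm
  by_cases hc0 : c = 0
  · left
    apply Subrepresentation.toSubmodule_injective
    show W.toSubmodule = ⊥
    rw [eq_bot_iff]
    intro w hw
    have hfix := Submodule.projection_apply_of_mem_left hc hw
    rw [hπ, hc0, zero_smul] at hfix
    rw [Submodule.mem_bot]
    exact hfix.symm
  · right
    apply Subrepresentation.toSubmodule_injective
    show W.toSubmodule = ⊤
    rw [eq_top_iff]
    intro v _
    have hm := Submodule.projection_apply_mem hc v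
    rw [hπ] at hm
    exact (Submodule.smul_mem_iff _ hc0).mp hm

end irreducible

/-! ## §3 Virtual characters of norm one: the Hom-stripping induction -/

section engine

variable {k : Type*} [Field k] [CharZero k] {G : Type*} [Group G] [Fintype G]

omit [CharZero k] in
/-- PROVED: `|G|` is invertible in a field of characteristic zero (the instance Mathlib's character lemmas want). [folklore] -/
theorem natCard_ne_zero [CharZero k] : (Nat.card G : k) ≠ 0 := by
  rw [Nat.card_eq_fintype_card]
  exact_mod_cast Fintype.card_ne_zero

/-- PROVED — the scalar product formula, multiplied out: `Σ_g χ_σ(g) χ_ρ(g⁻¹) = |G| · dim Hom_G(ρ, σ)`. [folklore] -/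
theorem sum_char_mul_char_inv {V W : Type*} [AddCommGroup V] [Module k V] [FiniteDimensional k V]
    [AddCommGroup W] [Module k W] [FiniteDimensional k W] (ρ : Representation k G V) (σ : Representation k G W) :
    ∑ g, σ.character g * ρ.character g⁻¹ = (Fintype.card G : k) * finrank k (IntertwiningMap ρ σ) := by
  haveI : Invertible (Nat.card G : k) := invertibleOfNonzero natCard_ne_zero
  have h := card_inv_mul_sum_char_mul_char_eq_finrank ρ σ
  rw [← Nat.card_eq_fintype_card, ← h, ← mul_assoc, mul_inv_cancel₀ natCard_ne_zero, one_mul]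

/-- PROVED — THE TERMINAL CASE: if `Hom_G(B, A) = 0 = Hom_G(A, B)`, the norm-one identity forces `B = 0` and `End_G(A) = k`. [folklore] -/
theorem exists_irreducible_of_hom_eq_zero {VA : Type u} {VB : Type v} [AddCommGroup VA] [Module k VA] [FiniteDimensional k VA]
    [AddCommGroup VB] [Module k VB] [FiniteDimensional k VB]
    (ρA : Representation k G VA) (ρB : Representation k G VB) (f : G → k)
    (hf : ∀ g, f g = ρA.character g - ρB.character g)
    (hnorm : ∑ g, f g * f g⁻¹ = Fintype.card G) (hdim : finrank k VB < finrank k VA)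
    (hBA : finrank k (IntertwiningMap ρB ρA) = 0) (hAB : finrank k (IntertwiningMap ρA ρB) = 0) :
    ∃ (U : Type u) (_ : AddCommGroup U) (_ : Module k U) (_ : FiniteDimensional k U) (ρU : Representation k G U),
      ρU.IsIrreducible ∧ finrank k (IntertwiningMap ρU ρU) = 1 ∧ ∀ g, ρU.character g = f g := by
  have hN : (Fintype.card G : k) ≠ 0 := by exact_mod_cast Fintype.card_ne_zero
  -- expand the norm
  have hexp : ∑ g, f g * f g⁻¹ = ∑ g, ((ρA.character g * ρA.character g⁻¹ - ρA.character g * ρB.character g⁻¹) -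
        (ρB.character g * ρA.character g⁻¹ - ρB.character g * ρB.character g⁻¹)) :=
    Finset.sum_congr rfl (fun g _ => by rw [hf, hf]; ring)
  rw [hexp, Finset.sum_sub_distrib, Finset.sum_sub_distrib, Finset.sum_sub_distrib, sum_char_mul_char_inv ρA ρA,
    sum_char_mul_char_inv ρB ρA, sum_char_mul_char_inv ρA ρB, sum_char_mul_char_inv ρB ρB, hBA, hAB] at hnorm
  have h1 : (Fintype.card G : k) * ((finrank k (IntertwiningMap ρA ρA) : k) + finrank k (IntertwiningMap ρB ρB) - 1) = 0 := by
    have h0 : ((0 : ℕ) : k) = 0 := Nat.cast_zero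
    rw [h0] at hnorm
    linear_combination hnorm
  have hsum : (finrank k (IntertwiningMap ρA ρA) : k) + finrank k (IntertwiningMap ρB ρB) = 1 := by
    rcases mul_eq_zero.mp h1 with h | h
    · exact absurd h hN
    · exact sub_eq_zero.mp h
  have hsum' : finrank k (IntertwiningMap ρA ρA) + finrank k (IntertwiningMap ρB ρB) = 1 := by exact_mod_cast hsum
  -- `A ≠ 0`, so `dim End_G A ≥ 1`
  haveI : Nontrivial VA := Module.nontrivial_of_finrank_pos (R := k) (by omega)
  have hA1 : 0 < finrank k (IntertwiningMap ρA ρA) := by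
    rw [Nat.pos_iff_ne_zero]
    intro h0
    have := (finrank_zero_iff_forall_zero.mp h0) (IntertwiningMap.id ρA)
    exact id_ne_zero ρA this
  have hEA : finrank k (IntertwiningMap ρA ρA) = 1 := by omega
  have hEB : finrank k (IntertwiningMap ρB ρB) = 0 := by omega
  -- hence `B = 0`
  have hB0 : ∀ v : VB, v = 0 := fun v => by
    have := (finrank_zero_iff_forall_zero.mp hEB) (IntertwiningMap.id ρB)
    have hv := congrArg (fun φ : IntertwiningMap ρB ρB => φ v) this
    simpa using hv
  have hχB : ∀ g, ρB.character g = 0 := fun g => by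
    have : ρB g = 0 := LinearMap.ext fun v => by rw [hB0 v, map_zero, map_zero]
    unfold Representation.character
    rw [this, map_zero]
  haveI : NeZero (Nat.card G : k) := ⟨natCard_ne_zero⟩
  exact ⟨VA, inferInstance, inferInstance, inferInstance, ρA, isIrreducible_of_finrank_intertwiningMap_eq_one ρA hEA, hEA,
    fun g => by rw [hf, hχB, sub_zero]⟩

/-- PROVED — THE INDUCTION (on `dim B`). [folklore] -/
theorem exists_irreducible_aux (n : ℕ) :
    ∀ {VA : Type u} {VB : Type v} [AddCommGroup VA] [Module k VA] [FiniteDimensional k VA]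
      [AddCommGroup VB] [Module k VB] [FiniteDimensional k VB]
      (ρA : Representation k G VA) (ρB : Representation k G VB) (f : G → k),
      (∀ g, f g = ρA.character g - ρB.character g) →
      ∑ g, f g * f g⁻¹ = Fintype.card G → finrank k VB < finrank k VA → finrank k VB ≤ n →
      ∃ (U : Type u) (_ : AddCommGroup U) (_ : Module k U) (_ : FiniteDimensional k U) (ρU : Representation k G U),
        ρU.IsIrreducible ∧ finrank k (IntertwiningMap ρU ρU) = 1 ∧ ∀ g, ρU.character g = f g := by
  induction n with
  | zero =>
    intro VA VB _ _ _ _ _ _ ρA ρB f hf hnorm hdim hn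
    have hB0 : ∀ v : VB, v = 0 := (finrank_zero_iff_forall_zero (K := k)).mp (by omega)
    have hBA : finrank k (IntertwiningMap ρB ρA) = 0 := by
      rw [finrank_zero_iff_forall_zero]
      intro φ
      exact IntertwiningMap.ext (LinearMap.ext fun v => by rw [hB0 v, map_zero, map_zero])
    have hAB : finrank k (IntertwiningMap ρA ρB) = 0 := by
      rw [finrank_zero_iff_forall_zero]
      intro φ
      exact IntertwiningMap.ext (LinearMap.ext fun v => by rw [hB0 (φ.toLinearMap v), hB0 ((0 : IntertwiningMap ρA ρB).toLinearMap v)])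
    exact exists_irreducible_of_hom_eq_zero ρA ρB f hf hnorm hdim hBA hAB
  | succ n ih =>
    intro VA VB _ _ _ _ _ _ ρA ρB f hf hnorm hdim hn
    by_cases hBA : finrank k (IntertwiningMap ρB ρA) = 0
    · by_cases hAB : finrank k (IntertwiningMap ρA ρB) = 0
      · exact exists_irreducible_of_hom_eq_zero ρA ρB f hf hnorm hdim hBA hAB
      · -- a non-zero intertwiner `ψ : A → B`: pass to `(ker ψ, B ∕ range ψ)`
        obtain ⟨ψ, hψ⟩ : ∃ ψ : IntertwiningMap ρA ρB, ψ ≠ 0 := by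
          by_contra hne
          push Not at hne
          exact hAB (finrank_zero_iff_forall_zero.mpr hne)
        have hpos := finrank_range_pos ρB ρA ψ hψ
        have h1 := finrank_ker_add_finrank_range ρB ρA ψ
        have h2 := finrank_quot_add_finrank ρB ψ.range
        refine ih ψ.ker.toRepresentation (quot ρB ψ.range) f (fun g => ?_) hnorm (by omega) (by omega)
        rw [hf, char_quot ρB ψ.range g, char_eq_char_ker_add_char_range ρB ρA ψ g]
        ring
    · -- a non-zero intertwiner `φ : B → A`: pass to `(A ∕ range φ, ker φ)`
      obtain ⟨φ, hφ⟩ : ∃ φ : IntertwiningMap ρB ρA, φ ≠ 0 := by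
        by_contra hne
        push Not at hne
        exact hBA (finrank_zero_iff_forall_zero.mpr hne)
      have hpos := finrank_range_pos ρA ρB φ hφ
      have h1 := finrank_ker_add_finrank_range ρA ρB φ
      have h2 := finrank_quot_add_finrank ρA φ.range
      refine ih (quot ρA φ.range) φ.ker.toRepresentation f (fun g => ?_) hnorm (by omega) (by omega)
      rw [hf, char_quot ρA φ.range g, char_eq_char_ker_add_char_range ρA ρB φ g]
      ring

/-- PROVED — **A VIRTUAL CHARACTER OF NORM ONE AND POSITIVE DEGREE IS A SCHURIAN IRREDUCIBLE CHARACTER**: if `f = χ_A − χ_B` for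
finite-dimensional representations `A`, `B` of the finite group `G` over a field `k` of characteristic zero, `Σ_g f(g)f(g⁻¹) = |G|` and
`dim B < dim A`, then `f` is the character of an irreducible subquotient `U` of `A` with `End_G(U) = k`. [cite: SerreLinearRepresentations1977, §2.3 Thm. 5]
(classical over `ℂ` via decomposition into simples; this proof strips intertwiners instead and needs no algebraic closure). -/
theorem exists_irreducible_of_virtual_normOne {VA : Type u} {VB : Type v} [AddCommGroup VA] [Module k VA] [FiniteDimensional k VA]
    [AddCommGroup VB] [Module k VB] [FiniteDimensional k VB]
    (ρA : Representation k G VA) (ρB : Representation k G VB) (f : G → k)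
    (hf : ∀ g, f g = ρA.character g - ρB.character g)
    (hnorm : ∑ g, f g * f g⁻¹ = Fintype.card G) (hdim : finrank k VB < finrank k VA) :
    ∃ (U : Type u) (_ : AddCommGroup U) (_ : Module k U) (_ : FiniteDimensional k U) (ρU : Representation k G U),
      ρU.IsIrreducible ∧ finrank k (IntertwiningMap ρU ρU) = 1 ∧ ∀ g, ρU.character g = f g :=
  exists_irreducible_aux (finrank k VB) ρA ρB f hf hnorm hdim le_rfl

end engine

end Summit.BirchSwinnertonDyer.BirchSwinnertonDyer.Theorems.CartanSupply.VirtualCharacter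

end
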